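import Literature.MathematicalPhysics.QuantumManyBody.PeriodicHeatFlowSpectral
import Literature.MathematicalPhysics.QuantumManyBody.PeriodicBoseGasTagged
import Literature.MathematicalPhysics.QuantumManyBody.GroundStateFeynmanKacHeatKernel
import HarnessLib

/-!
# Flat domination of the insertion partition function (line `residue-area-law`, stub 2)

Crux `BECInsertionCorrector.CorrectorClosure` (item stmt-AtomisticToContinuum-12058), line
`residue-area-law`, stub `stub_flatDomination`.

Let `Θ₀ : Config N → ℝ` be the `N`-body torus Feynman–Kac ground state
(`IsPeriodicGroundStateFK v L Θ₀`) and add one particle FLAT: `ψ₀ X = Θ₀ (vecTail X)` on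
`Config (N + 1)` (particle `0` is the inserted one). The flat insertion partition function is
`Z t = ∫⁻_{cellN (N+1) L} ψ₀ · e^{-tH_{N+1}} ψ₀`, read through `periodicFKSemigroup v L t`.

* `Z 0 = L³`: at `t = 0` the Feynman–Kac functional is the identity
  (`periodicFKSemigroup_of_nonpos`), and `∫_{cell × cellN N} Θ₀(Y)² dx dY = L³ · 1`.
* `Z t ≤ L³ e^{-tE₀(N)}` for `t ≥ 0`: by `periodicInteraction_succ` the `(N+1)`-body pair
  interaction is the (nonnegative) coupling of particle `0` to the bath PLUS the bath interaction
  of the tails, so along every sample the `(N+1)`-body action dominates the bath action of the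
  tail world-lines (`vecTail (worldLine X ω s) = worldLine (vecTail X) (ω ∘ succ) s`), whence the
  weight is dominated by the bath weight (`expNeg` is antitone). The bath weight and the
  observable depend on the sample only through the tail world-lines, and dropping the first
  world-line maps `wienerPaths (N+1)` onto `wienerPaths N` (product structure,
  `measurePreserving_piFinSuccAbove` + `measurePreserving_snd`), so
  `(e^{-tH_{N+1}} ψ₀)(X) ≤ (e^{-tH_N} Θ₀)(vecTail X) = e^{-tE₀(N)} Θ₀(vecTail X)` by the
  eigen-relation of `Θ₀`; integrating against `ψ₀` over the cell gives the claim.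
-/

noncomputable section

open MeasureTheory Filter Matrix
open scoped ENNReal NNReal BigOperators

namespace Summit.AtomisticToContinuum.BoseEinsteinCondensation.Theorems.CorrectorClosure.ResidueAreaLaw

open Literature.MathematicalPhysics.QuantumManyBody.BoseGas
open Literature.Probability.Process (preWienerMeasure)

variable {N : ℕ}

/-- The tails of the `N + 1` world-lines are the `N` world-lines of the tails (world-lines are
built coordinatewise). [folklore] -/
theorem flatDom_vecTail_worldLine (X : Config (N + 1)) (ω : PathSpace (N + 1)) (s : ℝ≥0) :
    vecTail (worldLine X ω s) = worldLine (vecTail X) (fun i => ω i.succ) s :=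
  rfl

/-- **Marginalising the first world-line**: dropping particle `0` from a sample of
`wienerPaths (N + 1)` is measure preserving onto `wienerPaths N` (the factors are probability
measures). [folklore] -/
theorem flatDom_measurePreserving_tail (N : ℕ) :
    MeasurePreserving (fun (ω : PathSpace (N + 1)) (i : Fin N) => ω i.succ)
      (wienerPaths (N + 1)) (wienerPaths N) := by
  haveI := Literature.Probability.RandomPlanarGeometry.isProbabilityMeasure_preWienerMeasure'
  exact (measurePreserving_snd (μ := Measure.pi fun _ : Fin 3 => preWienerMeasure)
    (ν := wienerPaths N)).comp
    (measurePreserving_piFinSuccAbove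
      (fun _ : Fin (N + 1) => (Measure.pi fun _ : Fin 3 => preWienerMeasure)) 0)

/-- A measurable functional of the tail world-lines integrates over `wienerPaths (N + 1)` as over
`wienerPaths N`. [folklore] -/
theorem flatDom_lintegral_tail {F : PathSpace N → ℝ≥0∞} (hF : Measurable F) :
    ∫⁻ ω, F (fun i => ω i.succ) ∂wienerPaths (N + 1) = ∫⁻ ω, F ω ∂wienerPaths N :=
  (flatDom_measurePreserving_tail N).lintegral_comp hF

/-- **The bath action of the tails is dominated by the `(N+1)`-body action** (drop the
nonnegative coupling `∑ⱼ v^per(x₀ - xⱼ)` of particle `0`, `periodicInteraction_succ`). [folklore] -/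
theorem flatDom_periodicPathAction_tail_le (v : ℝ → ℝ≥0∞) (L T : ℝ) (X : Config (N + 1))
    (ω : PathSpace (N + 1)) :
    periodicPathAction v L T (vecTail X) (fun i => ω i.succ) ≤ periodicPathAction v L T X ω := by
  unfold periodicPathAction
  refine lintegral_mono fun s => ?_
  rw [periodicInteraction_succ v L (worldLine X ω s.toNNReal)]
  exact le_add_self

/-- **The `(N+1)`-body Feynman–Kac weight is dominated by the bath weight of the tails.**
[folklore] -/
theorem flatDom_periodicFKWeight_le_tail (v : ℝ → ℝ≥0∞) (L T : ℝ) (X : Config (N + 1))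
    (ω : PathSpace (N + 1)) :
    periodicFKWeight v L T X ω ≤ periodicFKWeight v L T (vecTail X) (fun i => ω i.succ) :=
  expNeg_antitone (flatDom_periodicPathAction_tail_le v L T X ω)

/-- **Flat domination of the functional**: for an observable of the tails,
`(e^{-TH_{N+1}} (g ∘ tail))(X) ≤ (e^{-TH_N} g)(tail X)`. [folklore] -/
theorem flatDom_periodicFKSemigroup_tail_le {v : ℝ → ℝ≥0∞} (hv : Measurable v) (L T : ℝ)
    {g : Config N → ℝ≥0∞} (hg : Measurable g) (X : Config (N + 1)) :
    periodicFKSemigroup v L T (fun Y => g (vecTail Y)) X ≤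
      periodicFKSemigroup v L T g (vecTail X) := by
  unfold periodicFKSemigroup
  calc ∫⁻ ω, periodicFKWeight v L T X ω * g (vecTail (worldLine X ω T.toNNReal))
        ∂wienerPaths (N + 1)
      ≤ ∫⁻ ω, (fun ω' : PathSpace N => periodicFKWeight v L T (vecTail X) ω' *
          g (worldLine (vecTail X) ω' T.toNNReal)) (fun i => ω i.succ) ∂wienerPaths (N + 1) :=
        lintegral_mono fun ω => mul_le_mul' (flatDom_periodicFKWeight_le_tail v L T X ω) le_rfl
    _ = ∫⁻ ω', periodicFKWeight v L T (vecTail X) ω' * g (worldLine (vecTail X) ω' T.toNNReal)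
          ∂wienerPaths N :=
        flatDom_lintegral_tail
          ((measurable_periodicFKWeight hv L T _).mul (hg.comp (measurable_worldLine _ _)))

/-- **The cell integral of `Θ₀(tail) · (c · Θ₀(tail))` over `cellN (N + 1) L` is `c · L³`**
(Tonelli with the inserted coordinate outermost and `∫_{cellN N L} Θ₀² = 1`). [folklore] -/
theorem flatDom_setLIntegral_tail_mul {v : ℝ → ℝ≥0∞} {L : ℝ} (hL : 0 < L) {Θ₀ : Config N → ℝ}
    (hΘ : IsPeriodicGroundStateFK v L Θ₀) (c : ℝ≥0∞) :
    ∫⁻ X in cellN (N + 1) L, ENNReal.ofReal (Θ₀ (vecTail X)) *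
        (c * ENNReal.ofReal (Θ₀ (vecTail X))) = c * ENNReal.ofReal (L ^ 3) := by
  have hΘm : Measurable fun Y : Config N => ENNReal.ofReal (Θ₀ Y) :=
    ENNReal.measurable_ofReal.comp hΘ.measurable
  have hmeas : Measurable fun X : Config (N + 1) => ENNReal.ofReal (Θ₀ (vecTail X)) *
      (c * ENNReal.ofReal (Θ₀ (vecTail X))) :=
    (hΘm.comp measurable_vecTail).mul ((hΘm.comp measurable_vecTail).const_mul c)
  rw [setLIntegral_cellN_succ_left hmeas]
  simp only [Matrix.tail_cons]
  have hin : ∫⁻ Y in cellN N L, ENNReal.ofReal (Θ₀ Y) * (c * ENNReal.ofReal (Θ₀ Y)) = c := by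
    have hY : ∀ Y, ENNReal.ofReal (Θ₀ Y) * (c * ENNReal.ofReal (Θ₀ Y)) =
        c * ENNReal.ofReal (Θ₀ Y) ^ 2 := fun Y => by ring
    simp_rw [hY]
    rw [lintegral_const_mul _ (hΘm.pow_const 2), hΘ.norm_eq, mul_one]
  rw [hin, setLIntegral_const, volume_cell, ← ENNReal.ofReal_pow hL.le]

/-- **Stub 2 of line `residue-area-law` — flat domination: `𝒵(0) = L³` and
`𝒵(t) ≤ L³ e^{-tE₀(N)}` for every measurable `v ≥ 0`, fixed `N`, `L > 0`.** With
`ψ₀ = Θ₀ ∘ vecTail` (one particle added flat to the `N`-body torus Feynman–Kac ground state `Θ₀`)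
and `Z t = ∫_{cellN (N+1) L} ψ₀ · e^{-tH_{N+1}}ψ₀`: at `t = 0` the functional is the identity and
`Z 0 = L³ ∫Θ₀² = L³`; for `t ≥ 0`, dropping the nonnegative coupling of particle `0` to the bath
dominates the `(N+1)`-body weight by the bath weight of the tail world-lines, the first world-line
marginalises out of `wienerPaths (N + 1)`, and the eigen-relation `e^{-tH_N}Θ₀ = e^{-tE₀}Θ₀` gives
`Z t ≤ e^{-tE₀} L³`. [folklore] -/
theorem stub_flatDomination (v : ℝ → ℝ≥0∞) (hv : Measurable v) (N : ℕ) (L : ℝ) (hL : 0 < L)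
    (Θ₀ : Config N → ℝ) (hΘ : IsPeriodicGroundStateFK v L Θ₀) (Z : ℝ → ℝ≥0∞)
    (hZ : Z = fun t => ∫⁻ X in cellN (N + 1) L, ENNReal.ofReal (Θ₀ (vecTail X)) *
      periodicFKSemigroup v L t (fun Y => ENNReal.ofReal (Θ₀ (vecTail Y))) X) :
    Z 0 = ENNReal.ofReal (L ^ 3) ∧
    ∀ t : ℝ, 0 ≤ t →
      Z t ≤ ENNReal.ofReal (L ^ 3 * Real.exp (-((periodicGroundStateEnergy v N L).toReal * t))) := by
  subst hZ
  have hΘm : Measurable fun Y : Config N => ENNReal.ofReal (Θ₀ Y) :=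
    ENNReal.measurable_ofReal.comp hΘ.measurable
  refine ⟨?_, fun t ht => ?_⟩
  · simp only [periodicFKSemigroup_of_nonpos v L le_rfl]
    simpa only [one_mul] using flatDom_setLIntegral_tail_mul hL hΘ 1
  · calc ∫⁻ X in cellN (N + 1) L, ENNReal.ofReal (Θ₀ (vecTail X)) *
          periodicFKSemigroup v L t (fun Y => ENNReal.ofReal (Θ₀ (vecTail Y))) X
        ≤ ∫⁻ X in cellN (N + 1) L, ENNReal.ofReal (Θ₀ (vecTail X)) *
            (ENNReal.ofReal (Real.exp (-((periodicGroundStateEnergy v N L).toReal * t))) *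
              ENNReal.ofReal (Θ₀ (vecTail X))) := by
          refine lintegral_mono fun X => mul_le_mul' le_rfl ?_
          calc periodicFKSemigroup v L t (fun Y => ENNReal.ofReal (Θ₀ (vecTail Y))) X
              ≤ periodicFKSemigroup v L t (fun Y => ENNReal.ofReal (Θ₀ Y)) (vecTail X) :=
                flatDom_periodicFKSemigroup_tail_le hv L t hΘm X
            _ = ENNReal.ofReal (Real.exp (-((periodicGroundStateEnergy v N L).toReal * t)) *
                  Θ₀ (vecTail X)) := hΘ.eigen t ht (vecTail X)
            _ = _ := ENNReal.ofReal_mul (Real.exp_nonneg _)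
      _ = ENNReal.ofReal (Real.exp (-((periodicGroundStateEnergy v N L).toReal * t))) *
            ENNReal.ofReal (L ^ 3) := flatDom_setLIntegral_tail_mul hL hΘ _
      _ = ENNReal.ofReal (L ^ 3 * Real.exp (-((periodicGroundStateEnergy v N L).toReal * t))) := by
          rw [ENNReal.ofReal_mul (pow_nonneg hL.le 3), mul_comm]

end Summit.AtomisticToContinuum.BoseEinsteinCondensation.Theorems.CorrectorClosure.ResidueAreaLaw
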